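import Summits.SmoothPoincare4.SmoothPoincare4.Theses.InformationMetricHadamard
import Literature.Geometry.Manifold.InverseFunctionTheorem
import Literature.Geometry.Lorentzian.Isometry

/-!
# The transition map of two `C⁰`-cone collars (helper for stub `stub_twoCollarConformality`,
line `Sketch`, crux `InformationMetricHadamard.C0AhRecognition`, item stmt-SmoothPoincare4-6015)

Proved bookkeeping (kind = proof, no definitions) for two end collars `Φ : Σ × (0,1) → W⁵`,
`Ψ : N × (0,1) → W⁵` of one Riemannian 5-manifold `(W, G)`: `far_subset_far` (deep `Φ`-points far +
far `Ψ`-parts co-compact ⇒ every `Ψ(N × (0,t))` contains some `Φ(Σ × (0,s))`; no connectedness or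
completeness of `W`); the transition map `T = invFunOn Ψ (N × (0,1)) ∘ Φ` (a closed term):
`transition_spec`, `transition_image_subset` / `subset_transition_image` (cofinal both ways),
`injOn_transition`, `mapsTo_transition`; `transition_local` (`T = L ∘ Φ` near a point over the
immersive part of `Ψ`, `L` a smooth local inverse — inverse function theorem `4 + 1 = 5` — so `T` is
`C^∞` and `dΨ ∘ dT = dΦ`); `transition_almostConformal` (the two `C⁰`-asymptotics clauses make `dT`
pointwise `(1+o(1))`-conformal between the PRODUCT metrics `g ⊕ dλ²`, `gN ⊕ dμ²`, factor
`κ = c μ²/(c' λ²)`). Steps 1–5 of the reduction of "Liouville at infinity" to quasiconformal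
boundary theory. [folklore]
-/

noncomputable section

-- the prescribed namespace `Summit.<P>.<Sub>.…` duplicates `SmoothPoincare4` (P = Sub)
set_option linter.dupNamespace false

open scoped Manifold ContDiff Topology ENNReal NNReal
open Set Function Filter

namespace Summit.SmoothPoincare4.SmoothPoincare4.Cruxes.C0AhRecognition.Sketch

open Literature.Geometry.Lorentzian (PseudoRiemannianMetric)

/-! ## Far parts of one collar nest into far parts of the other -/

section Nesting

variable {A B W : Type*} [TopologicalSpace W] [T2Space W]
  [ChartedSpace (EuclideanSpace ℝ (Fin 5)) W] [IsManifold (𝓡 5) ∞ W]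
  {G : PseudoRiemannianMetric (𝓡 5) ∞ (EuclideanSpace ℝ (Fin 5)) (TangentSpace (𝓡 5) : W → Type _)}
  {hG : G.IsRiemannian}

/-- **Nesting of far parts.** If the deep points of `Φ` are `G`-far from every base point (`hfarΦ`,
stub C) and the far parts of `Ψ` are co-compact (`hco'`), then every far part of `Ψ` contains a far
part of `Φ`: cover the compact `(Ψ(B × (0,t)))ᶜ` by finitely many unit `G`-distance balls and go
below the depths at which `Φ` leaves each of them. No connectedness or completeness of `W` is used.
[folklore] -/
theorem far_subset_far {Φ : A × ℝ → W} {Ψ : B × ℝ → W}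
    (hfarΦ : ∀ (x₀ : W) (R : NNReal), ∃ t ∈ Ioo (0 : ℝ) 1, ∀ (x : A) (l : ℝ),
      l ∈ Ioo (0 : ℝ) t → (R : ℝ≥0∞) < G.edist hG x₀ (Φ (x, l)))
    (hco' : ∀ t ∈ Ioo (0 : ℝ) 1, IsCompact (Ψ '' (univ ×ˢ Ioo (0 : ℝ) t))ᶜ)
    {t : ℝ} (ht : t ∈ Ioo (0 : ℝ) 1) :
    ∃ s ∈ Ioo (0 : ℝ) 1, Φ '' (univ ×ˢ Ioo (0 : ℝ) s) ⊆ Ψ '' (univ ×ˢ Ioo (0 : ℝ) t) := by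
  haveI : LocallyCompactSpace W := ChartedSpace.locallyCompactSpace (EuclideanSpace ℝ (Fin 5)) W
  have hKc : IsCompact (Ψ '' (univ ×ˢ Ioo (0 : ℝ) t))ᶜ := hco' t ht
  obtain ⟨F, -, hKF⟩ := hKc.elim_nhds_subcover (fun w ↦ {y : W | G.edist hG w y < 1})
    (fun w _ ↦ PseudoRiemannianMetric.setOf_edist_lt_mem_nhds hG w one_pos)
  choose tf htf hfar using fun w : W ↦ hfarΦ w 1
  -- the common depth: below `1/2` and below every `tf w`, `w ∈ F`
  set D : Finset ℝ := insert (1 / 2 : ℝ) (F.image tf) with hD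
  have hDne : D.Nonempty := Finset.insert_nonempty _ _
  set s : ℝ := D.min' hDne with hs
  have hs_le : ∀ w ∈ F, s ≤ tf w := fun w hw ↦
    Finset.min'_le _ _ (Finset.mem_insert_of_mem (Finset.mem_image_of_mem tf hw))
  have hs_pos : 0 < s := by
    rw [hs, Finset.lt_min'_iff]
    intro y hy
    rcases Finset.mem_insert.1 hy with rfl | hy
    · norm_num
    · obtain ⟨w, -, rfl⟩ := Finset.mem_image.1 hy
      exact (htf w).1
  refine ⟨s, ⟨hs_pos, (Finset.min'_le _ _ (Finset.mem_insert_self _ _)).trans_lt one_half_lt_one⟩,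
    ?_⟩
  rintro _ ⟨⟨x, l⟩, ⟨-, hl⟩, rfl⟩
  by_contra hmem
  obtain ⟨w, hwF, hw⟩ := mem_iUnion₂.1 (hKF hmem)
  have hlt : ((1 : NNReal) : ℝ≥0∞) < G.edist hG w (Φ (x, l)) :=
    hfar w x l ⟨hl.1, lt_of_lt_of_le hl.2 (hs_le w hwF)⟩
  rw [ENNReal.coe_one] at hlt
  exact absurd hw (not_lt.2 hlt.le)

end Nesting

/-! ## The transition map `T = Ψ⁻¹ ∘ Φ` -/

section TransitionMap

variable {X N W : Type} [Nonempty N]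

-- the transition map `T = Ψ⁻¹ ∘ Φ` is the closed term `invFunOn Ψ (univ ×ˢ Ioo 0 1) ∘ Φ` throughout
variable {Φ : X × ℝ → W} {Ψ : N × ℝ → W}

/-- Where `Φ p ∈ Ψ(N × (0,t))`, `t ≤ 1`, the transition map takes the (unique) preimage:
`T p ∈ N × (0,t)` and `Ψ (T p) = Φ p`. [folklore] -/
theorem transition_spec (hinj' : InjOn Ψ (univ ×ˢ Ioo (0 : ℝ) 1)) {t : ℝ} (ht : t ≤ 1)
    {p : X × ℝ} (hp : Φ p ∈ Ψ '' (univ ×ˢ Ioo (0 : ℝ) t)) :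
    (invFunOn Ψ (univ ×ˢ Ioo (0 : ℝ) 1) ∘ Φ) p ∈ univ ×ˢ Ioo (0 : ℝ) t ∧
      Ψ ((invFunOn Ψ (univ ×ˢ Ioo (0 : ℝ) 1) ∘ Φ) p) = Φ p := by
  obtain ⟨q, hq, hqp⟩ := hp
  have hqΩ : q ∈ univ ×ˢ Ioo (0 : ℝ) 1 := ⟨mem_univ _, hq.2.1, lt_of_lt_of_le hq.2.2 ht⟩
  have hT : (invFunOn Ψ (univ ×ˢ Ioo (0 : ℝ) 1) ∘ Φ) p = q := by
    rw [comp_apply, ← hqp]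
    exact hinj'.leftInvOn_invFunOn hqΩ
  rw [hT]
  exact ⟨hq, hqp⟩

/-- **Cofinality of the transition map, outwards** (`cof1`): a far part of `Φ` nested in
`Ψ(N × (0,t))` is mapped by `T` into `N × (0,t)`. [folklore] -/
theorem transition_image_subset (hinj' : InjOn Ψ (univ ×ˢ Ioo (0 : ℝ) 1)) {s t : ℝ} (ht : t ≤ 1)
    (hnest : Φ '' (univ ×ˢ Ioo (0 : ℝ) s) ⊆ Ψ '' (univ ×ˢ Ioo (0 : ℝ) t)) :
    (invFunOn Ψ (univ ×ˢ Ioo (0 : ℝ) 1) ∘ Φ) '' (univ ×ˢ Ioo (0 : ℝ) s) ⊆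
      univ ×ˢ Ioo (0 : ℝ) t := by
  rintro _ ⟨p, hp, rfl⟩
  exact (transition_spec hinj' ht (hnest (mem_image_of_mem Φ hp))).1

/-- **Cofinality of the transition map, inwards** (`cof2`): a far part of `Ψ` nested in
`Φ(X × (0,s))` lies in the image `T(X × (0,s))`. [folklore] -/
theorem subset_transition_image (hinj' : InjOn Ψ (univ ×ˢ Ioo (0 : ℝ) 1)) {s t : ℝ} (ht : t ≤ 1)
    (hnest' : Ψ '' (univ ×ˢ Ioo (0 : ℝ) t) ⊆ Φ '' (univ ×ˢ Ioo (0 : ℝ) s)) :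
    (univ ×ˢ Ioo (0 : ℝ) t : Set (N × ℝ)) ⊆
      (invFunOn Ψ (univ ×ˢ Ioo (0 : ℝ) 1) ∘ Φ) '' (univ ×ˢ Ioo (0 : ℝ) s) := by
  intro q hq
  obtain ⟨p, hp, hpq⟩ := hnest' (mem_image_of_mem Ψ hq)
  refine ⟨p, hp, ?_⟩
  have hqΩ : q ∈ univ ×ˢ Ioo (0 : ℝ) 1 := ⟨mem_univ _, hq.2.1, lt_of_lt_of_le hq.2.2 ht⟩
  rw [comp_apply, hpq]
  exact hinj'.leftInvOn_invFunOn hqΩ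

/-- **Injectivity of the transition map** on a far part of `Φ` nested in the collar of `Ψ`.
[folklore] -/
theorem injOn_transition (hinj : InjOn Φ (univ ×ˢ Ioo (0 : ℝ) 1))
    (hinj' : InjOn Ψ (univ ×ˢ Ioo (0 : ℝ) 1)) {s t : ℝ} (hs : s ≤ 1) (ht : t ≤ 1)
    (hnest : Φ '' (univ ×ˢ Ioo (0 : ℝ) s) ⊆ Ψ '' (univ ×ˢ Ioo (0 : ℝ) t)) :
    InjOn (invFunOn Ψ (univ ×ˢ Ioo (0 : ℝ) 1) ∘ Φ) (univ ×ˢ Ioo (0 : ℝ) s) := by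
  intro p hp p' hp' hpp'
  have h1 := (transition_spec hinj' ht (hnest (mem_image_of_mem Φ hp))).2
  have h2 := (transition_spec hinj' ht (hnest (mem_image_of_mem Φ hp'))).2
  have hΦ : Φ p = Φ p' := by rw [← h1, ← h2, hpp']
  have hsub : (univ ×ˢ Ioo (0 : ℝ) s : Set (X × ℝ)) ⊆ univ ×ˢ Ioo (0 : ℝ) 1 :=
    prod_mono Subset.rfl (Ioo_subset_Ioo_right hs)
  exact hinj (hsub hp) (hsub hp') hΦ

/-- The transition map sends a far part of `Φ` nested in the collar of `Ψ` into `N × (0,∞)`.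
[folklore] -/
theorem mapsTo_transition (hinj' : InjOn Ψ (univ ×ˢ Ioo (0 : ℝ) 1)) {s t : ℝ} (ht : t ≤ 1)
    (hnest : Φ '' (univ ×ˢ Ioo (0 : ℝ) s) ⊆ Ψ '' (univ ×ˢ Ioo (0 : ℝ) t)) :
    MapsTo (invFunOn Ψ (univ ×ˢ Ioo (0 : ℝ) 1) ∘ Φ) (univ ×ˢ Ioo (0 : ℝ) s) (univ ×ˢ Ioi (0 : ℝ)) :=
  fun _ hp ↦ ⟨mem_univ _, (transition_spec hinj' ht (hnest (mem_image_of_mem Φ hp))).1.2.1⟩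

variable [TopologicalSpace X] [ChartedSpace (EuclideanSpace ℝ (Fin 4)) X] [IsManifold (𝓡 4) ∞ X]
  [TopologicalSpace N] [ChartedSpace (EuclideanSpace ℝ (Fin 4)) N] [IsManifold (𝓡 4) ∞ N]
  [TopologicalSpace W] [ChartedSpace (EuclideanSpace ℝ (Fin 5)) W] [IsManifold (𝓡 5) ∞ W]

omit [IsManifold (𝓡 4) ∞ X] in
/-- **Local form of the transition map.** At a point `p` of the collar domain of `Φ` with
`Φ p ∈ Ψ(N × (0,1))` and `dΨ` injective at `T p`, the transition map agrees near `p` with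
`L ∘ Φ` for a smooth local inverse `L` of `Ψ` at `T p` (inverse function theorem, `4 + 1 = 5`);
hence it is smooth at `p` and `dΨ_{T p} ∘ dT_p = dΦ_p`. [folklore] -/
theorem transition_local
    (hsm : ContMDiffOn ((𝓡 4).prod 𝓘(ℝ, ℝ)) (𝓡 5) ∞ Φ (univ ×ˢ Ioo (0 : ℝ) 1))
    (hsm' : ContMDiffOn ((𝓡 4).prod 𝓘(ℝ, ℝ)) (𝓡 5) ∞ Ψ (univ ×ˢ Ioo (0 : ℝ) 1))
    (hinj' : InjOn Ψ (univ ×ˢ Ioo (0 : ℝ) 1))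
    {s t : ℝ} (hs : s ≤ 1) (ht : t ≤ 1)
    (hnest : Φ '' (univ ×ˢ Ioo (0 : ℝ) s) ⊆ Ψ '' (univ ×ˢ Ioo (0 : ℝ) t))
    (himm : ∀ q ∈ univ ×ˢ Ioo (0 : ℝ) t,
      Injective (mfderiv ((𝓡 4).prod 𝓘(ℝ, ℝ)) (𝓡 5) Ψ q))
    {p : X × ℝ} (hp : p ∈ univ ×ˢ Ioo (0 : ℝ) s) :
    ContMDiffAt ((𝓡 4).prod 𝓘(ℝ, ℝ)) ((𝓡 4).prod 𝓘(ℝ, ℝ)) ∞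
        (invFunOn Ψ (univ ×ˢ Ioo (0 : ℝ) 1) ∘ Φ) p ∧
      ∀ u : TangentSpace ((𝓡 4).prod 𝓘(ℝ, ℝ)) p,
        mfderiv ((𝓡 4).prod 𝓘(ℝ, ℝ)) (𝓡 5) Ψ ((invFunOn Ψ (univ ×ˢ Ioo (0 : ℝ) 1) ∘ Φ) p)
            (mfderiv ((𝓡 4).prod 𝓘(ℝ, ℝ)) ((𝓡 4).prod 𝓘(ℝ, ℝ))
              (invFunOn Ψ (univ ×ˢ Ioo (0 : ℝ) 1) ∘ Φ) p u) =
          mfderiv ((𝓡 4).prod 𝓘(ℝ, ℝ)) (𝓡 5) Φ p u := by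
  set T := invFunOn Ψ (univ ×ˢ Ioo (0 : ℝ) 1) ∘ Φ with hTdef
  have hΩXo : IsOpen (univ ×ˢ Ioo (0 : ℝ) 1 : Set (X × ℝ)) := isOpen_univ.prod isOpen_Ioo
  have hΩNo : IsOpen (univ ×ˢ Ioo (0 : ℝ) 1 : Set (N × ℝ)) := isOpen_univ.prod isOpen_Ioo
  have hfarXo : IsOpen (univ ×ˢ Ioo (0 : ℝ) s : Set (X × ℝ)) := isOpen_univ.prod isOpen_Ioo
  have hfarX_sub : (univ ×ˢ Ioo (0 : ℝ) s : Set (X × ℝ)) ⊆ univ ×ˢ Ioo (0 : ℝ) 1 :=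
    prod_mono Subset.rfl (Ioo_subset_Ioo_right hs)
  have hpΩ : p ∈ (univ ×ˢ Ioo (0 : ℝ) 1 : Set (X × ℝ)) := hfarX_sub hp
  -- the preimage point `q = T p`
  have hspec : ∀ p' ∈ (univ ×ˢ Ioo (0 : ℝ) s : Set (X × ℝ)),
      T p' ∈ univ ×ˢ Ioo (0 : ℝ) t ∧ Ψ (T p') = Φ p' := fun p' hp' ↦
    transition_spec hinj' ht (hnest (mem_image_of_mem Φ hp'))
  obtain ⟨hqt, hΨq⟩ := hspec p hp
  set q := T p with hqdef
  have hqΩ : q ∈ (univ ×ˢ Ioo (0 : ℝ) 1 : Set (N × ℝ)) := ⟨mem_univ _, hqt.2.1, hqt.2.2.trans_le ht⟩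
  -- `Ψ` is a local diffeomorphism at `q`
  have hdim : Module.finrank ℝ (EuclideanSpace ℝ (Fin 4) × ℝ) =
      Module.finrank ℝ (EuclideanSpace ℝ (Fin 5)) := by
    rw [Module.finrank_prod, finrank_euclideanSpace_fin, finrank_euclideanSpace_fin,
      Module.finrank_self]
  have hloc : IsLocalDiffeomorphAt ((𝓡 4).prod 𝓘(ℝ, ℝ)) (𝓡 5) ∞ Ψ q := by
    set L' : (EuclideanSpace ℝ (Fin 4) × ℝ) ≃ₗ[ℝ] EuclideanSpace ℝ (Fin 5) :=
      Literature.Geometry.Lorentzian.mfderivEquivOfInjective (I := 𝓡 5)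
        (I' := (𝓡 4).prod 𝓘(ℝ, ℝ)) Ψ q (himm q hqt) hdim with hL'
    refine Literature.Geometry.Manifold.isLocalDiffeomorphAt_of_mfderiv (by simp) hΩNo hqΩ hsm'
      L'.toContinuousLinearEquiv ?_
    ext u
    rfl
  set L := hloc.localInverse with hLdef
  -- the open set on which `invFunOn Ψ` is given by `L`
  set O : Set W := L.source ∩ L ⁻¹' (univ ×ˢ Ioo (0 : ℝ) 1) with hO
  have hOo : IsOpen O :=
    L.contMDiffOn_toFun.continuousOn.isOpen_inter_preimage L.open_source hΩNo
  have hLinv : ∀ y ∈ O, invFunOn Ψ (univ ×ˢ Ioo (0 : ℝ) 1) y = L y := by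
    intro y hy
    have h1 : Ψ (L y) = y := hloc.localInverse_right_inv hy.1
    conv_lhs => rw [← h1]
    exact hinj'.leftInvOn_invFunOn hy.2
  have hΦpO : Φ p ∈ O := by
    rw [← hΨq]
    refine ⟨hloc.localInverse_mem_source, ?_⟩
    show L (Ψ q) ∈ univ ×ˢ Ioo (0 : ℝ) 1
    rw [hloc.localInverse_left_inv hloc.localInverse_mem_target]
    exact hqΩ
  -- `T = L ∘ Φ` near `p`
  have hUo : IsOpen ((univ ×ˢ Ioo (0 : ℝ) 1 : Set (X × ℝ)) ∩ Φ ⁻¹' O) :=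
    hsm.continuousOn.isOpen_inter_preimage hΩXo hOo
  have hev : T =ᶠ[𝓝 p] (L ∘ Φ) := by
    filter_upwards [hUo.mem_nhds ⟨hpΩ, hΦpO⟩] with p' hp'
    exact hLinv (Φ p') hp'.2
  -- smoothness at `p`
  have hΦat : ContMDiffAt ((𝓡 4).prod 𝓘(ℝ, ℝ)) (𝓡 5) ∞ Φ p := hsm.contMDiffAt (hΩXo.mem_nhds hpΩ)
  have hLat : ContMDiffAt (𝓡 5) ((𝓡 4).prod 𝓘(ℝ, ℝ)) ∞ L (Ψ q) := hloc.localInverse_contMDiffAt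
  have hTat : ContMDiffAt ((𝓡 4).prod 𝓘(ℝ, ℝ)) ((𝓡 4).prod 𝓘(ℝ, ℝ)) ∞ T p :=
    (hLat.comp_of_eq hΦat hΨq.symm).congr_of_eventuallyEq hev
  refine ⟨hTat, fun u ↦ ?_⟩
  -- the chain rule for `Ψ ∘ T = Φ` near `p`
  have hTd : HasMFDerivAt ((𝓡 4).prod 𝓘(ℝ, ℝ)) ((𝓡 4).prod 𝓘(ℝ, ℝ)) T p
      (mfderiv ((𝓡 4).prod 𝓘(ℝ, ℝ)) ((𝓡 4).prod 𝓘(ℝ, ℝ)) T p) :=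
    (hTat.mdifferentiableAt (by simp)).hasMFDerivAt
  have hΨd : HasMFDerivAt ((𝓡 4).prod 𝓘(ℝ, ℝ)) (𝓡 5) Ψ (T p)
      (mfderiv ((𝓡 4).prod 𝓘(ℝ, ℝ)) (𝓡 5) Ψ (T p)) :=
    ((hsm'.contMDiffAt (hΩNo.mem_nhds hqΩ)).mdifferentiableAt (by simp)).hasMFDerivAt
  have hcomp := hΨd.comp p hTd
  have hev2 : Φ =ᶠ[𝓝 p] (Ψ ∘ T) := by
    filter_upwards [hfarXo.mem_nhds hp] with p' hp'
    exact ((hspec p' hp').2).symm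
  have hΦd := hcomp.congr_of_eventuallyEq hev2
  rw [hΦd.mfderiv]
  rfl

/-! ### `dT` is `(1 + o(1))`-conformal between the product metrics -/

/-- Elementary core of `transition_almostConformal`: two relative approximations `|X - a| ≤ δ a`,
`|X - b| ≤ δ b` of the same quantity with `δ ≤ 1/2` force `|b - a| ≤ 4 δ a`. [folklore] -/
theorem abs_sub_le_of_two_approx {X a b δ : ℝ} (hδ0 : 0 ≤ δ) (hδ : δ ≤ 1 / 2) (ha : 0 ≤ a)
    (hb : 0 ≤ b) (h1 : |X - a| ≤ δ * a) (h2 : |X - b| ≤ δ * b) : |b - a| ≤ 4 * δ * a := by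
  rw [abs_sub_le_iff] at h1 h2
  obtain ⟨h1a, h1b⟩ := h1
  obtain ⟨h2a, h2b⟩ := h2
  -- `(1 - δ) b ≤ (1 + δ) a`, hence `b ≤ 3 a`
  have hb3 : b ≤ 3 * a := by nlinarith
  rw [abs_sub_le_iff]
  constructor <;> nlinarith

/-- `G_b(a,a)` only depends on the base point up to transport of `a` in the (trivialised) tangent
spaces. [folklore] -/
private theorem val_congr_point
    (G : PseudoRiemannianMetric (𝓡 5) ∞ (EuclideanSpace ℝ (Fin 5))
      (TangentSpace (𝓡 5) : W → Type _)) {b b' : W} (h : b = b') (a : EuclideanSpace ℝ (Fin 5)) :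
    G.val b a a = G.val b' a a := by
  subst h
  rfl

/-- A Riemannian metric has nonnegative squares. [folklore] -/
private theorem val_self_nonneg (g : PseudoRiemannianMetric (𝓡 4) ∞ (EuclideanSpace ℝ (Fin 4))
    (TangentSpace (𝓡 4) : X → Type _)) (hg : g.IsRiemannian) (x : X) (v : TangentSpace (𝓡 4) x) :
    0 ≤ g.val x v v := by
  by_cases hv : v = 0
  · simp [hv]
  · exact (hg x v hv).le

/-- **Asymptotic conformality of the transition map between the product metrics.** Dividing the
asymptotics clause of `Φ` at `(x,λ)` by that of `Ψ` at `T(x,λ)` (deep, by `far_subset_far`) along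
`dΨ ∘ dT = dΦ`: for `λ < s'(ε)`,
`|(gN ⊕ dμ²)(dT u, dT u) - κ (g ⊕ dλ²)(u,u)| ≤ ε κ (g ⊕ dλ²)(u,u)` with `κ = c μ² / (c' λ²)`.
[folklore] -/
theorem transition_almostConformal [T2Space W]
    (g : PseudoRiemannianMetric (𝓡 4) ∞ (EuclideanSpace ℝ (Fin 4))
      (TangentSpace (𝓡 4) : X → Type _)) (hg : g.IsRiemannian)
    (gN : PseudoRiemannianMetric (𝓡 4) ∞ (EuclideanSpace ℝ (Fin 4))
      (TangentSpace (𝓡 4) : N → Type _)) (hgN : gN.IsRiemannian)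
    (G : PseudoRiemannianMetric (𝓡 5) ∞ (EuclideanSpace ℝ (Fin 5))
      (TangentSpace (𝓡 5) : W → Type _)) {hG : G.IsRiemannian}
    (hsm : ContMDiffOn ((𝓡 4).prod 𝓘(ℝ, ℝ)) (𝓡 5) ∞ Φ (univ ×ˢ Ioo (0 : ℝ) 1))
    (hsm' : ContMDiffOn ((𝓡 4).prod 𝓘(ℝ, ℝ)) (𝓡 5) ∞ Ψ (univ ×ˢ Ioo (0 : ℝ) 1))
    (hinj' : InjOn Ψ (univ ×ˢ Ioo (0 : ℝ) 1))
    {c c' : ℝ} (hc : 0 < c) (hc' : 0 < c')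
    (hasym : ∀ ε : ℝ, 0 < ε → ∃ t ∈ Ioo (0 : ℝ) 1, ∀ (x : X) (l : ℝ), l ∈ Ioo (0 : ℝ) t →
      ∀ (v : TangentSpace (𝓡 4) x) (s : ℝ),
        |G.val (Φ (x, l)) (mfderiv ((𝓡 4).prod 𝓘(ℝ, ℝ)) (𝓡 5) Φ (x, l) (v, s))
            (mfderiv ((𝓡 4).prod 𝓘(ℝ, ℝ)) (𝓡 5) Φ (x, l) (v, s)) -
          c * (s ^ 2 + g.val x v v) / l ^ 2| ≤ ε * (c * (s ^ 2 + g.val x v v) / l ^ 2))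
    (hasym' : ∀ ε : ℝ, 0 < ε → ∃ t ∈ Ioo (0 : ℝ) 1, ∀ (y : N) (l : ℝ), l ∈ Ioo (0 : ℝ) t →
      ∀ (v : TangentSpace (𝓡 4) y) (s : ℝ),
        |G.val (Ψ (y, l)) (mfderiv ((𝓡 4).prod 𝓘(ℝ, ℝ)) (𝓡 5) Ψ (y, l) (v, s))
            (mfderiv ((𝓡 4).prod 𝓘(ℝ, ℝ)) (𝓡 5) Ψ (y, l) (v, s)) -
          c' * (s ^ 2 + gN.val y v v) / l ^ 2| ≤ ε * (c' * (s ^ 2 + gN.val y v v) / l ^ 2))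
    (hfarΦ : ∀ (x₀ : W) (R : NNReal), ∃ t ∈ Ioo (0 : ℝ) 1, ∀ (x : X) (l : ℝ),
      l ∈ Ioo (0 : ℝ) t → (R : ℝ≥0∞) < G.edist hG x₀ (Φ (x, l)))
    (hco' : ∀ t ∈ Ioo (0 : ℝ) 1, IsCompact (Ψ '' (univ ×ˢ Ioo (0 : ℝ) t))ᶜ)
    {s₀ t₁ : ℝ} (hs₀ : s₀ ∈ Ioo (0 : ℝ) 1) (ht₁ : t₁ ∈ Ioo (0 : ℝ) 1)
    (hnest₀ : Φ '' (univ ×ˢ Ioo (0 : ℝ) s₀) ⊆ Ψ '' (univ ×ˢ Ioo (0 : ℝ) t₁))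
    (himm₁ : ∀ q ∈ univ ×ˢ Ioo (0 : ℝ) t₁,
      Injective (mfderiv ((𝓡 4).prod 𝓘(ℝ, ℝ)) (𝓡 5) Ψ q)) :
    ∀ ε : ℝ, 0 < ε → ∃ s' ∈ Ioo (0 : ℝ) s₀, ∀ (x : X) (l : ℝ), l ∈ Ioo (0 : ℝ) s' →
      ∃ κ : ℝ, 0 < κ ∧ ∀ (v : TangentSpace (𝓡 4) x) (σ : ℝ) (w : EuclideanSpace ℝ (Fin 4) × ℝ),
        mfderiv ((𝓡 4).prod 𝓘(ℝ, ℝ)) ((𝓡 4).prod 𝓘(ℝ, ℝ))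
            (invFunOn Ψ (univ ×ˢ Ioo (0 : ℝ) 1) ∘ Φ) (x, l) (v, σ) = w →
        |gN.val ((invFunOn Ψ (univ ×ˢ Ioo (0 : ℝ) 1) ∘ Φ) (x, l)).1 w.1 w.1 + w.2 ^ 2 -
            κ * (g.val x v v + σ ^ 2)| ≤
          ε * (κ * (g.val x v v + σ ^ 2)) := by
  intro ε hε
  -- the relative error of each asymptotics clause
  set δ : ℝ := min (1 / 2) (ε / 4) with hδ
  have hδ0 : 0 < δ := lt_min (by norm_num) (by linarith)
  have hδhalf : δ ≤ 1 / 2 := min_le_left _ _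
  have hδε : 4 * δ ≤ ε := by linarith [min_le_right (1 / 2 : ℝ) (ε / 4)]
  obtain ⟨tΦ, htΦ, hΦ⟩ := hasym δ hδ0
  obtain ⟨tΨ, htΨ, hΨ⟩ := hasym' δ hδ0
  -- depth below which `T` lands in `N × (0, min tΨ t₁)`
  have htm : min tΨ t₁ ∈ Ioo (0 : ℝ) 1 :=
    ⟨lt_min htΨ.1 ht₁.1, lt_of_le_of_lt (min_le_left _ _) htΨ.2⟩
  obtain ⟨s₁, hs₁, hnest₁⟩ := far_subset_far hfarΦ hco' htm
  set s' : ℝ := min (min (s₀ / 2) tΦ) s₁ with hs'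
  have hs'pos : 0 < s' := lt_min (lt_min (by linarith [hs₀.1]) htΦ.1) hs₁.1
  have hs's₀ : s' < s₀ := by
    have h1 : s' ≤ s₀ / 2 := (min_le_left _ _).trans (min_le_left _ _)
    linarith [hs₀.1]
  have hs'tΦ : s' ≤ tΦ := (min_le_left _ _).trans (min_le_right _ _)
  have hs's₁ : s' ≤ s₁ := min_le_right _ _
  refine ⟨s', ⟨hs'pos, hs's₀⟩, fun x l hl ↦ ?_⟩
  -- the point, its image, and the identities `Ψ (T p) = Φ p`, `dΨ ∘ dT = dΦ`
  have hp₀ : ((x, l) : X × ℝ) ∈ (univ ×ˢ Ioo (0 : ℝ) s₀ : Set (X × ℝ)) :=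
    ⟨mem_univ _, hl.1, hl.2.trans hs's₀⟩
  have hp₁ : ((x, l) : X × ℝ) ∈ (univ ×ˢ Ioo (0 : ℝ) s₁ : Set (X × ℝ)) :=
    ⟨mem_univ _, hl.1, lt_of_lt_of_le hl.2 hs's₁⟩
  obtain ⟨hTfar, hΨT⟩ := transition_spec hinj' htm.2.le (hnest₁ (mem_image_of_mem Φ hp₁))
  obtain ⟨-, hchain⟩ := transition_local hsm hsm' hinj' hs₀.2.le ht₁.2.le hnest₀ himm₁ hp₀
  set q := (invFunOn Ψ (univ ×ˢ Ioo (0 : ℝ) 1) ∘ Φ) (x, l) with hq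
  have hμ0 : 0 < q.2 := hTfar.2.1
  have hμΨ : q.2 < tΨ := lt_of_lt_of_le hTfar.2.2 (min_le_left _ _)
  have hl0 : 0 < l := hl.1
  -- the conformal factor `κ = c μ² / (c' λ²)`
  refine ⟨c * q.2 ^ 2 / (c' * l ^ 2), by positivity, fun v σ w hw ↦ ?_⟩
  -- the clause of `Φ` at `(x, l)` in the direction `(v, σ)`
  have h1 := hΦ x l ⟨hl.1, lt_of_lt_of_le hl.2 hs'tΦ⟩ v σ
  -- the clause of `Ψ` at `q = T (x, l)` in the direction `w = dT (v, σ)`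
  have h2 : |G.val (Ψ q) (mfderiv ((𝓡 4).prod 𝓘(ℝ, ℝ)) (𝓡 5) Ψ q w)
        (mfderiv ((𝓡 4).prod 𝓘(ℝ, ℝ)) (𝓡 5) Ψ q w) -
        c' * (w.2 ^ 2 + gN.val q.1 w.1 w.1) / q.2 ^ 2| ≤
      δ * (c' * (w.2 ^ 2 + gN.val q.1 w.1 w.1) / q.2 ^ 2) :=
    hΨ q.1 q.2 ⟨hμ0, hμΨ⟩ w.1 w.2
  have hdw : mfderiv ((𝓡 4).prod 𝓘(ℝ, ℝ)) (𝓡 5) Ψ q w =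
      mfderiv ((𝓡 4).prod 𝓘(ℝ, ℝ)) (𝓡 5) Φ (x, l) (v, σ) := by
    rw [← hw]
    exact hchain (v, σ)
  have hval : G.val (Ψ q) (mfderiv ((𝓡 4).prod 𝓘(ℝ, ℝ)) (𝓡 5) Ψ q w)
        (mfderiv ((𝓡 4).prod 𝓘(ℝ, ℝ)) (𝓡 5) Ψ q w) =
      G.val (Φ (x, l)) (mfderiv ((𝓡 4).prod 𝓘(ℝ, ℝ)) (𝓡 5) Φ (x, l) (v, σ))
        (mfderiv ((𝓡 4).prod 𝓘(ℝ, ℝ)) (𝓡 5) Φ (x, l) (v, σ)) := by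
    rw [hdw]
    exact val_congr_point G hΨT _
  rw [hval] at h2
  -- compare the two relative approximations of the same `G`-value
  have hgv : 0 ≤ g.val x v v := val_self_nonneg g hg x v
  have hgw : 0 ≤ gN.val q.1 w.1 w.1 := val_self_nonneg gN hgN q.1 w.1
  have ha : 0 ≤ c * (σ ^ 2 + g.val x v v) / l ^ 2 := by positivity
  have hb : 0 ≤ c' * (w.2 ^ 2 + gN.val q.1 w.1 w.1) / q.2 ^ 2 := by positivity
  have hcore := abs_sub_le_of_two_approx hδ0.le hδhalf ha hb h1 h2
  -- rescale by `μ² / c'`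
  have hc'0 : c' ≠ 0 := hc'.ne'
  have hl0' : l ≠ 0 := hl0.ne'
  have hμ0' : q.2 ≠ 0 := hμ0.ne'
  have hkey : gN.val q.1 w.1 w.1 + w.2 ^ 2 - c * q.2 ^ 2 / (c' * l ^ 2) * (g.val x v v + σ ^ 2) =
      q.2 ^ 2 / c' * (c' * (w.2 ^ 2 + gN.val q.1 w.1 w.1) / q.2 ^ 2 -
        c * (σ ^ 2 + g.val x v v) / l ^ 2) := by
    field_simp
    ring
  have hpos : 0 < q.2 ^ 2 / c' := by positivity
  have hκQ : 0 ≤ c * q.2 ^ 2 / (c' * l ^ 2) * (g.val x v v + σ ^ 2) := by positivity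
  rw [hkey, abs_mul, abs_of_pos hpos]
  calc q.2 ^ 2 / c' * |c' * (w.2 ^ 2 + gN.val q.1 w.1 w.1) / q.2 ^ 2 -
          c * (σ ^ 2 + g.val x v v) / l ^ 2|
        ≤ q.2 ^ 2 / c' * (4 * δ * (c * (σ ^ 2 + g.val x v v) / l ^ 2)) := by gcongr
    _ = 4 * δ * (c * q.2 ^ 2 / (c' * l ^ 2) * (g.val x v v + σ ^ 2)) := by
          field_simp
          ring
    _ ≤ ε * (c * q.2 ^ 2 / (c' * l ^ 2) * (g.val x v v + σ ^ 2)) := by gcongr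

end TransitionMap

end Summit.SmoothPoincare4.SmoothPoincare4.Cruxes.C0AhRecognition.Sketch

end
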